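import Literature.NumberTheory.GaloisRepresentations.ArtinRestriction
import Mathlib.Data.Nat.Prime.Factorial
import Mathlib.FieldTheory.KrullTopology
import Mathlib.FieldTheory.IntermediateField.Adjoin.Basic
import Mathlib.GroupTheory.GroupAction.Quotient
import Mathlib.GroupTheory.OrderOfElement
import Mathlib.Data.Finite.Perm
import Mathlib.Topology.Algebra.Group.ClosedSubgroup
import HarnessLib

/-!
# A prime-to-`p` NORMAL level of `Γ_K` fixing prescribed algebraic numbers — row T-RD-E346 file K1
# (cell `b2b-bsdres`, team n1011; seat n1011-p05 gen 6)

HONEST FRAMING (cell `b2b-bsdres`, run/shared/lean/b2b/bsd-rank1-residual/, verbatim in every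
file): the goal of the cell is to DELETE the COMBINATION-SHAPED residual classes of the
Birch–Swinnerton-Dyer formula for ALL analytic-rank `≤ 1` elliptic curves over `ℚ` — "full BSD
formula for every rank `≤ 1` curve in class `C`" assembled STRICTLY from published theorems — so
that the rank-`≤ 1` remainder becomes exactly the CONSTRUCTION-SHAPED classes, which are TYPED
(missing-input `Prop`s), NOT attempted. This is not "finishing BSD". Team n1011 (X4 ∧ `p = 3`,
§I N10/N11): research route; TOOL theorems of group / Galois theory, ALL UNCONDITIONAL; no
definition, no named fact; nothing booked; no label changes.

## What (and why)

The R-D identification on the `(G-ord)` rows of semistability defect `e ∈ {3, 4, 6}` (row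
T-RD-E346, skeleton `cells/n1011/skel/T-RD-E346.md`) runs Greenberg's Prop. 2.4 for a GOOD MODEL
`W₀ = C • E ⊗ K̄_v` (cc-typer-2's typed S2 `Greenberg1999.imKummer_ge_strictCondition_goodOrdinaryModel`)
at a layer `H = ker κ ⊓ U` whose local Galois group FIXES `C`, and then descends / ascends from
`ker κ ⊓ U` to `ker κ = Gal(ℚ̄/ℚ_∞)` along an index `[Γ_ℚ : U]` PRIME TO `p` (p05 F2
`strictKer_le_localKerOver_kerSubgroup_of_index_coprime`, p07
`localKerOver_le_greenbergKer_kerSubgroup_of_index_coprime`, both for `U` open NORMAL). The entries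
of `C` are algebraic numbers of small degree (a Kummer generator `θ`, `θ^e = p`, `e ∣ p − 1`); this
file supplies the level:

* `index_normalCore_dvd_factorial` — `[G : core(H)] ∣ [G : H]!` (the core is the kernel of
  `G → Sym(G/H)`, Mathlib `Subgroup.normalCore_eq_ker`);
* `isOpen_normalCore_of_isOpen` — the core of an open subgroup of finite index of a topological
  group is open (closed of finite index);
* `exists_normal_isOpen_index_dvd_factorial_smul_eq` — for `x ∈ K̄` with `deg (minpoly_K x) ≤ n`
  there is an open NORMAL `U ≤ Γ_K` with `[Γ_K : U] ∣ n!` fixing `x` (the core of `Gal(K̄/K(x))`,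
  whose index is `[K(x) : K]`, Mathlib `IntermediateField.finrank_eq_fixingSubgroup_index`);
* `exists_normal_isOpen_coprime_smul_eq` / `…_pair` — for a prime `p > n` the index is prime to
  `p`; two elements at once (intersection of the two cores; `relIndex_dvd_index_of_normal`);
* `smul_absClosureEmbedding_eq_of_absGaloisRestrict_mem` — LOCAL form: an element of `Γ_L`
  (`L ⊇ K`, e.g. `L = K_v`) whose restriction to `Γ_K` lies in such a `U` fixes the image of `x`
  under the chosen embedding `K̄ → L̄` (tree `absGaloisRestrict_apply_smul`).

References: J. Neukirch, *Algebraic Number Theory*, IV §1 (Krull topology, closed subgroups of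
finite index) [NeukirchANT]; J.-P. Serre, *Galois Cohomology*, I §2.4, II §1.1; D. S. Dummit,
R. M. Foote, *Abstract Algebra*, §4.2 (the core of a subgroup as the kernel of the coset action).
-/

noncomputable section

open scoped Classical IntermediateField

namespace Summit.BirchSwinnertonDyer.Rank1Residual.GaloisImage

open Field Literature.NumberTheory.GaloisRepresentations

/-! ## §1 Group theory: the normal core of a subgroup of finite index -/

section Group

variable {G : Type*} [Group G] (H : Subgroup G)

/-- **`[G : core(H)] ∣ [G : H]!`**: the normal core of `H` is the kernel of the action of `G` on
`G/H` (Mathlib `Subgroup.normalCore_eq_ker`), whose image is a subgroup of `Sym(G/H)`, of order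
dividing `[G : H]!`. [folklore] -/
theorem index_normalCore_dvd_factorial [H.FiniteIndex] : H.normalCore.index ∣ Nat.factorial H.index := by
  rw [Subgroup.normalCore_eq_ker, Subgroup.index_ker]
  have h := Subgroup.card_subgroup_dvd_card (MulAction.toPermHom G (G ⧸ H)).range
  rwa [Nat.card_perm] at h

variable [TopologicalSpace G] [IsTopologicalGroup G]

/-- The normal core of an OPEN subgroup of finite index of a topological group is open (it is
closed — Mathlib `Subgroup.normalCore_isClosed` — and of finite index). [folklore] -/
theorem isOpen_normalCore_of_isOpen [H.FiniteIndex] (hH : IsOpen (H : Set G)) :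
    IsOpen (H.normalCore : Set G) :=
  Subgroup.isOpen_of_isClosed_of_finiteIndex _
    (Subgroup.normalCore_isClosed H (Subgroup.isClosed_of_isOpen H hH))

end Group

/-! ## §2 An open normal level of `Γ_K` of index dividing `n!` fixing an algebraic number of
degree `≤ n` -/

section Level

variable (K : Type*) [Field K] [CharZero K]

/-- **An open NORMAL subgroup of `Γ_K` of index dividing `n!` fixing `x`**, for `x ∈ K̄` with
`deg minpoly_K(x) ≤ n`: the normal core of `Gal(K̄/K(x))`, which is open of index
`[K(x) : K] = deg minpoly_K(x)` (Mathlib `IntermediateField.finrank_eq_fixingSubgroup_index`,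
`IntermediateField.adjoin.finrank`). [folklore] -/
theorem exists_normal_isOpen_index_dvd_factorial_smul_eq (x : AlgebraicClosure K) {n : ℕ}
    (hx : (minpoly K x).natDegree ≤ n) :
    ∃ U : Subgroup (absoluteGaloisGroup K), U.Normal ∧ IsOpen (U : Set (absoluteGaloisGroup K)) ∧
      U.index ∣ Nat.factorial n ∧ ∀ σ ∈ U, σ • x = x := by
  haveI : IsGalois K (AlgebraicClosure K) := {}
  have hint : IsIntegral K x := Algebra.IsIntegral.isIntegral x
  set E : IntermediateField K (AlgebraicClosure K) := K⟮x⟯ with hE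
  haveI : FiniteDimensional K E := IntermediateField.adjoin.finiteDimensional hint
  set H : Subgroup (absoluteGaloisGroup K) := E.fixingSubgroup with hH
  have hHo : IsOpen (H : Set (absoluteGaloisGroup K)) := E.fixingSubgroup_isOpen
  have hidx' : E.fixingSubgroup.index = (minpoly K x).natDegree :=
    (IntermediateField.finrank_eq_fixingSubgroup_index E).symm.trans
      (by rw [hE]; exact IntermediateField.adjoin.finrank hint)
  have hidx : H.index = (minpoly K x).natDegree := by rw [hH]; exact hidx'
  haveI : H.FiniteIndex := ⟨by rw [hidx]; exact (minpoly.natDegree_pos hint).ne'⟩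
  refine ⟨H.normalCore, inferInstance, isOpen_normalCore_of_isOpen H hHo, ?_, ?_⟩
  · exact (index_normalCore_dvd_factorial H).trans (by rw [hidx]; exact Nat.factorial_dvd_factorial hx)
  · intro σ hσ
    have hσH : σ ∈ H := H.normalCore_le hσ
    exact (mem_fixingSubgroup_iff_forall_smul E σ).1 hσH ⟨x, IntermediateField.mem_adjoin_simple_self K x⟩

/-- For a prime `p > n`: an open NORMAL subgroup of `Γ_K` of index PRIME TO `p` fixing an algebraic
number of degree `≤ n` (`p ∤ n!`). [folklore] -/
theorem exists_normal_isOpen_coprime_smul_eq {p : ℕ} (hp : p.Prime) (x : AlgebraicClosure K) {n : ℕ}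
    (hx : (minpoly K x).natDegree ≤ n) (hn : n < p) :
    ∃ U : Subgroup (absoluteGaloisGroup K), U.Normal ∧ IsOpen (U : Set (absoluteGaloisGroup K)) ∧
      U.index.Coprime p ∧ ∀ σ ∈ U, σ • x = x := by
  obtain ⟨U, hUn, hUo, hUi, hUx⟩ := exists_normal_isOpen_index_dvd_factorial_smul_eq K x hx
  refine ⟨U, hUn, hUo, ?_, hUx⟩
  have hcop : (Nat.factorial n).Coprime p := (hp.coprime_factorial_of_lt hn).symm
  exact hcop.coprime_dvd_left hUi

/-- **Two algebraic numbers at once**: for a prime `p` exceeding both degrees, an open NORMAL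
subgroup of `Γ_K` of index PRIME TO `p` fixing `x` and `y` (the intersection of the two cores;
`[G : U₁ ∩ U₂] = [U₂ : U₁ ∩ U₂]·[G : U₂]` and `[U₂ : U₁ ∩ U₂] ∣ [G : U₁]` for `U₁` normal).
[folklore] -/
theorem exists_normal_isOpen_coprime_smul_eq_pair {p : ℕ} (hp : p.Prime)
    (x y : AlgebraicClosure K) {a b : ℕ} (hx : (minpoly K x).natDegree ≤ a)
    (hy : (minpoly K y).natDegree ≤ b) (ha : a < p) (hb : b < p) :
    ∃ U : Subgroup (absoluteGaloisGroup K), U.Normal ∧ IsOpen (U : Set (absoluteGaloisGroup K)) ∧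
      U.index.Coprime p ∧ ∀ σ ∈ U, σ • x = x ∧ σ • y = y := by
  obtain ⟨U₁, hU₁n, hU₁o, hU₁i, hU₁x⟩ := exists_normal_isOpen_coprime_smul_eq K hp x hx ha
  obtain ⟨U₂, hU₂n, hU₂o, hU₂i, hU₂y⟩ := exists_normal_isOpen_coprime_smul_eq K hp y hy hb
  refine ⟨U₁ ⊓ U₂, inferInstance, ?_, ?_, fun σ hσ ↦ ⟨hU₁x σ (Subgroup.mem_inf.1 hσ).1,
    hU₂y σ (Subgroup.mem_inf.1 hσ).2⟩⟩
  · rw [Subgroup.coe_inf]; exact hU₁o.inter hU₂o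
  · have h1 : (U₁ ⊓ U₂).index = U₁.relIndex U₂ * U₂.index := by
      rw [← Subgroup.inf_relIndex_right U₁ U₂, Subgroup.relIndex_mul_index inf_le_right]
    have h2 : U₁.relIndex U₂ ∣ U₁.index := Subgroup.relIndex_dvd_index_of_normal U₁ U₂
    rw [h1]
    exact Nat.coprime_mul_iff_left.mpr ⟨hU₁i.coprime_dvd_left h2, hU₂i⟩

end Level

/-! ## §3 Local form along the chosen embedding `K̄ → L̄` -/

section Local

variable (K L : Type*) [Field K] [Field L] [Algebra K L]

/-- **Local fixing**: if every element of `U ≤ Γ_K` fixes `x ∈ K̄`, then every `τ ∈ Γ_L` whose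
restriction `absGaloisRestrict K L τ` lies in `U` fixes the image of `x` in `L̄` under the chosen
embedding (`absGaloisRestrict_apply_smul`: `ι (res τ • x) = τ • ι x`). [folklore] -/
theorem smul_absClosureEmbedding_eq_of_absGaloisRestrict_mem {U : Subgroup (absoluteGaloisGroup K)}
    {x : AlgebraicClosure K} (hU : ∀ σ ∈ U, σ • x = x) (τ : absoluteGaloisGroup L)
    (hτ : absGaloisRestrict K L τ ∈ U) :
    τ • absClosureEmbedding K L x = absClosureEmbedding K L x := by
  rw [← absGaloisRestrict_apply_smul, hU _ hτ]

/-- Local fixing of a power / of any element of the subring generated: if `τ` fixes `ι x` it fixes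
`(ι x) ^ n` and `(ι x)⁻¹`-free expressions; recorded for the Kummer scaling `u = (ι θ)^m`
(`m : ℤ`). [folklore] -/
theorem smul_absClosureEmbedding_zpow_eq_of_absGaloisRestrict_mem
    {U : Subgroup (absoluteGaloisGroup K)} {x : AlgebraicClosure K} (hU : ∀ σ ∈ U, σ • x = x)
    (τ : absoluteGaloisGroup L) (hτ : absGaloisRestrict K L τ ∈ U) (m : ℤ) :
    τ • (absClosureEmbedding K L x ^ m) = absClosureEmbedding K L x ^ m := by
  rw [Field.absoluteGaloisGroup.smul_def, map_zpow₀, ← Field.absoluteGaloisGroup.smul_def,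
    smul_absClosureEmbedding_eq_of_absGaloisRestrict_mem K L hU τ hτ]

end Local

end Summit.BirchSwinnertonDyer.Rank1Residual.GaloisImage

end
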